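import Summits.ValiantsHypothesis.ValiantsHypothesis.Theorems.BarrierLeverPartitionMinorsHitByVPOfLowerSetsDoors

/-!
# Route BarrierLever — support item `AnchoredDoorHitsLowerPairs` (stmt-ValiantsHypothesis-22510), line `anchored-peeling`:
# DEFINITIONS (verbatim from the registered skeleton)

Definitions file for the prover side of the registered skeleton
`Cruxes/AnchoredDoorHitsLowerPairs/Lines/anchored_peeling.lean` (planner valiant-natproofs-p1 g19, D-0145; lane val-np-p1).
The Cruxes module is not an importable build target, so the objects the line posits are restated here VERBATIM (same names,
same bodies) under the Theorems namespace `…BarrierLever.AnchoredPeeling`; stub landings (`…StubGenericPoint`, …) import this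
file. Cell valiant-natproofs, rung V4, 𝒟-side door (c); prover seat val-np-p1 gen 14.

Contents: `anchors`, `anchoredWitness` (the anchored door 𝔄_s with total parameter functions), `AnchoredHit`, `Param`,
`symbolicWitness` (parameters = indeterminates), `symbolicDet` (the symbolic partition minor), and the stub / link statements
`Stmt.stub_genericPoint`, `Stmt.stub_symbolicNonvanishing`, `Stmt.anchoredDoor` — all verbatim. (The profile-(1,1),(1,2),(2,1)
door with twists over all variables, `AnchoredDoor.anchoredDoor` of `…PartitionMinorsHitByVPAnchoredDoor`, is the seat's earlier
concrete instance; the two differ only in bookkeeping.)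

WHAT THIS IS NOT: statements only; nothing is proved here; nothing on crux stmt-ValiantsHypothesis-14610 or `VP` versus `VNP`.
-/

set_option linter.dupNamespace false

namespace Summit.ValiantsHypothesis.ValiantsHypothesis.Theorems.BarrierLever.AnchoredPeeling

open Finset MvPolynomial
open Literature.Barriers.ValiantsHypothesis (SmallCircuits)

noncomputable section

variable {h : ℕ}

/-- The anchors of profile `≤ s`: pairs `(A | B)` with `1 ≤ |A| ≤ s`, `1 ≤ |B| ≤ s`. (Verbatim from the skeleton.) -/
def anchors (s h : ℕ) : Finset (Finset (Fin h) × Finset (Fin h)) :=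
  Finset.univ.filter fun p => 1 ≤ p.1.card ∧ p.1.card ≤ s ∧ 1 ≤ p.2.card ∧ p.2.card ≤ s

/-- The anchored witness 𝔄_s with complex parameters `θ φ ψ` (values outside `anchors s h` are irrelevant). (Verbatim.) -/
def anchoredWitness (s h : ℕ) (θ : Finset (Fin h) × Finset (Fin h) → ℂ)
    (φ ψ : Finset (Fin h) × Finset (Fin h) → Fin h → ℂ) : MvPolynomial (Fin (h + h)) ℂ :=
  ∏ α ∈ anchors s h, (1 + C (θ α) * (∏ a ∈ α.1, X (Fin.castAdd h a)) * (∏ c ∈ α.2, X (Fin.natAdd h c)) *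
    (∏ b ∈ univ \ α.1, (1 + C (φ α b) * X (Fin.castAdd h b))) *
    (∏ d ∈ univ \ α.2, (1 + C (ψ α d) * X (Fin.natAdd h d))))

/-- `AnchoredHit s h r u w`: some member of 𝔄_s has a nonzero partition minor on the layout `(u, w)`. (Verbatim.) -/
def AnchoredHit (s h r : ℕ) (u w : Fin r → Finset (Fin h)) : Prop :=
  ∃ (θ : Finset (Fin h) × Finset (Fin h) → ℂ) (φ ψ : Finset (Fin h) × Finset (Fin h) → Fin h → ℂ),
    (Matrix.of fun i j : Fin r => MvPolynomial.coeff
      (∑ a ∈ u i, Finsupp.single (Fin.castAdd h a) 1 + ∑ c ∈ w j, Finsupp.single (Fin.natAdd h c) 1)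
      (anchoredWitness s h θ φ ψ)).det ≠ 0

/-- Parameter indices: `θ_α`, `φ_{α b}`, `ψ_{α d}`. (Verbatim.) -/
abbrev Param (h : ℕ) : Type :=
  (Finset (Fin h) × Finset (Fin h)) ⊕ ((Finset (Fin h) × Finset (Fin h)) × Fin h) ⊕ ((Finset (Fin h) × Finset (Fin h)) × Fin h)

/-- The symbolic anchored witness, coefficients in the parameter ring `ℂ[θ, φ, ψ]`. (Verbatim.) -/
def symbolicWitness (s h : ℕ) : MvPolynomial (Fin (h + h)) (MvPolynomial (Param h) ℂ) :=
  ∏ α ∈ anchors s h, (1 + C (X (Sum.inl α)) * (∏ a ∈ α.1, X (Fin.castAdd h a)) * (∏ c ∈ α.2, X (Fin.natAdd h c)) *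
    (∏ b ∈ univ \ α.1, (1 + C (X (Sum.inr (Sum.inl (α, b)))) * X (Fin.castAdd h b))) *
    (∏ d ∈ univ \ α.2, (1 + C (X (Sum.inr (Sum.inr (α, d)))) * X (Fin.natAdd h d))))

/-- The symbolic partition minor of the layout `(u, w)`. (Verbatim.) -/
def symbolicDet (s h r : ℕ) (u w : Fin r → Finset (Fin h)) : MvPolynomial (Param h) ℂ :=
  (Matrix.of fun i j : Fin r => MvPolynomial.coeff
    (∑ a ∈ u i, Finsupp.single (Fin.castAdd h a) 1 + ∑ c ∈ w j, Finsupp.single (Fin.natAdd h c) 1)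
    (symbolicWitness s h)).det

/-- Stub 1 statement (verbatim): a nonzero symbolic minor has a complex non-root (generic point). -/
def Stmt.stub_genericPoint : Prop :=
  ∀ (s h r : ℕ) (u w : Fin r → Finset (Fin h)), symbolicDet s h r u w ≠ 0 → AnchoredHit s h r u w

/-- Stub 2 statement (verbatim): symbolic non-vanishing on every injective simplicial-complex pair, for a fixed profile bound. -/
def Stmt.stub_symbolicNonvanishing : Prop :=
  ∃ s h₀ : ℕ, ∀ h : ℕ, h₀ ≤ h → ∀ (r : ℕ) (u w : Fin r → Finset (Fin h)),
    Function.Injective u → Function.Injective w →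
    IsLowerSet (Set.range u) → IsLowerSet (Set.range w) →
    symbolicDet s h r u w ≠ 0

/-- The door statement (verbatim): size of 𝔄_s for fixed `s`, the hypothesis of the skeleton's link to item 19717. -/
def Stmt.anchoredDoor : Prop :=
  ∀ s : ℕ, ∃ b h₀ : ℕ, ∀ h : ℕ, h₀ ≤ h → ∀ (r : ℕ) (u w : Fin r → Finset (Fin h)),
    AnchoredHit s h r u w →
    ∃ f ∈ SmallCircuits ℂ (h + h) b,
      (Matrix.of fun i j : Fin r => MvPolynomial.coeff
        (∑ a ∈ u i, Finsupp.single (Fin.castAdd h a) 1 + ∑ c ∈ w j, Finsupp.single (Fin.natAdd h c) 1) f).det ≠ 0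

end

end Summit.ValiantsHypothesis.ValiantsHypothesis.Theorems.BarrierLever.AnchoredPeeling
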